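import Summits.SmoothPoincare4.SmoothPoincare4.Theses.EntropyRung
import Summits.SmoothPoincare4.SmoothPoincare4.Theorems.SubcylindricalExistence.Negative.Window
import Summits.SmoothPoincare4.SmoothPoincare4.Theorems.SubcylindricalExistence.Negative.Logic
import Summits.SmoothPoincare4.SmoothPoincare4.Theorems.EntropyRungSubcylindricalExistenceFloorBridge
import Summits.SmoothPoincare4.SmoothPoincare4.Theorems.EntropyRungSubcylindricalExistenceScalarPositiveUpgrade
import Summits.SmoothPoincare4.SmoothPoincare4.Theorems.EntropyRungSubcylindricalExistenceConeCapping
import Literature.Geometry.Riemannian.SharpLogSobolevAVR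

/-!
# Line `fat-conical-core-avr-logsobolev` for the crux `EntropyRung.SubcylindricalExistence`
(stmt-SmoothPoincare4-10871) — lead c4 skeleton, reshape R-c4 ("conformal cone gauge")

ENT := every closed smooth homotopy 4-sphere `M` carries a Riemannian metric with `R > 0` and
`ν(g) > ν_cyl = log Θ(S³×ℝ) = log 2 + ½ log π − 3/2`.

The line (idea card `fat-conical-core-avr-logsobolev`, planner skeleton
`Lines/fat-conical-core-avr-logsobolev.lean`): a complete `Ric ≥ 0` core on the punctured homotopy
sphere with an exactly conical end of slope `c`, `c³ > Θ(S³×ℝ)`, gets the scale-uniform entropy floor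
`𝒲 − τ∫Ru ≥ log c³` from the sharp AVR log-Sobolev inequality (Balogh–Kristály–Tripaldi,
arXiv:2210.15774 = J. Funct. Anal. 2024, Thm 1.1, `p = 2`, `N = 4`), is capped inside `M` to a closed
metric with `R ≥ 0`, `R ≢ 0`, `ν > ν_cyl`, and is then conformally nudged to `R > 0`.

RESHAPE R-c4 (this file). The planner typed the core data with an abstract cone chart `ψ`
(`ψ*h = dr² + c²r²g_{S³}`) and a polar chart `β = ι ∘ ψ ∘ (inversion)`; capping then needs a two-piece
gluing of bundle sections and the curvature of doubly-warped products in Cartesian coordinates. The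
4-d warped products over the round `S³` are CONFORMALLY FLAT, so we re-gauge: the transfer stub now
delivers a GLOBAL metric `g` on `M` which is EUCLIDEAN in the atlas chart at `p`
(exactly the clause of c2/c3's Schoen-gauge stubs), and a conformal factor `Λ`, smooth and positive
on `{p}ᶜ`, which is the CONE FACTOR `Λ = c‖y‖^{−c−1}` in that chart (so `Λ²g = c²ρ^{−2c−2}δ =
ds² + c²s²g_{S³}`, `s = ρ^{−c}`: the exact cone of slope `c`, large end at the puncture); the core
`(P, h)` is an abstract complete `Ric ≥ 0` manifold of AVR `c³` identified with `({p}ᶜ, Λ²g)` by an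
explicit inverse pair `ι : P → M`, `σ : M → P` with `h = ι^*(Λ²g)` pointwise. Then
* the FLOOR is stated on `M` in the shape of c3's blow-up clause (`Λ⁴ dV_g`, `Λ⁻²|∇w|²_g`, test
  functions vanishing near `p`) — `stub_floorBridge` derives it from BKT Thm 1.1 (now the Literature
  named fact `Literature.Geometry.Riemannian.sharpLogSobolevAVR_four`, p132456) by transport along `ι`;
* the CAPPING metric is a CONFORMAL change `G = Φ²g` of the global `g` (`Φ = Λ` off a chart ball,
  `Φ = e^{w(ρ)}` radial inside: exact cone → logarithmically slow opening → huge round cap in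
  stereographic presentation), so realisation, Levi-Civita, curvature (`R_{Φ²g} = Φ⁻³(RΦ − 6ΔΦ)`)
  and the cap-side clause (round profile in a flat chart ⇒ RoundBound level `log 6 − 2`) are the
  landed tools of lines curvature-dimension / green-blowup (`exists_isRiemannian_conformal_sq`,
  `scalarCurvature_conformal_sq_four`, `roundClauseEuclidean`, `sphereSideClause'`,
  `wEntropy_localisation_two`, `wClause_sq_of_wClause_exp`, `gluingCutoffCost`, …);
* the UPGRADE `R ≥ 0, R ≢ 0 ⇒ R > 0` is stated with an explicit entropy loss `ε` (honest: a
  conformal nudge `(1 + tφ)²G`, `φ` the ground state of `−Δ + R/6`, `R_t = (R + 6tλφ)(1+tφ)⁻³ > 0`,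
  moves `μ` by `O(t)` uniformly in the scale only after Sobolev absorption of the gradient
  discrepancy).
Composition: `SubcylindricalExistence_of : BKT → coneCore → SubcylindricalExistence` (sorry-free, by
name; floorBridge p129780, coneCapping p132383 and upgrade p130772 are LANDED Theorems and are
discharged inside it). STATUS v5: `sorry` only in stub B (= the Literature named fact, unproved) and
stub T (the transfer). The transfer stub `stub_coneCoreExistence` is the
SPC4-hard bet of the line (true on `S⁴`: `g` = round metric flattened at `p`, `Λ²g` = flat `ℝ⁴`,
`c = 1`, `ι`/`σ` = stereographic pair); its independent content is the explicit-constant gap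
conjecture "complete `Ric ≥ 0`, AVR `> Θ(S³×ℝ) = .791` on `Σ ∖ pt` forces `Σ ≅ S⁴`" (Cheeger–Colding
1997 A.1.11 only at AVR `≥ 1 − δ(4)`).

Disproof used: the item's evidence notes (Disproof v1–v6; the file itself is not readable from this
jail) and the landed `Negative/{ConstTest,Window,Logic,BlowupExistence}`: no `_false_without_` theorem
exists for this crux; `Window.nuCyl_lt_nuRound` is the cap's margin (`cap_margin` below);
`BlowupExistence.spc4_of_blowupExistence` (PMT rigidity of the EXACT Euclidean gauge) does not bite
here: the conical end has a genuine angle defect (`c < 1` allowed) and `c = 1` forces flatness only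
of the END, not of the core.
-/

noncomputable section

open scoped Manifold ContDiff Topology ENNReal NNReal ContinuousMap RealInnerProductSpace

set_option linter.dupNamespace false
open Set Filter Function MeasureTheory
open Literature.Geometry.Lorentzian Literature.Geometry.Riemannian

namespace Summit.SmoothPoincare4.SmoothPoincare4.Cruxes.SubcylindricalExistence.FatConicalCoreAvrLogsobolev

open Summit.SmoothPoincare4.SmoothPoincare4.Theses.EntropyRung

/-! ## Vocabulary of the line (named `Prop`s; the registered `stub_*` below unfold them verbatim) -/

section Vocabulary

variable (M : Type) [TopologicalSpace M] [ChartedSpace (EuclideanSpace ℝ (Fin 4)) M] [IsManifold (𝓡 4) ∞ M]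

/-- **The metric is Euclidean in the atlas chart at `p` on the closed ball of radius `r`** (the clause
of the Schoen-gauge stubs of line green-blowup, verbatim): `closedBall (φ p) r ⊆ φ.target` for
`φ = extChartAt p`, and `g(dφ⁻¹X, dφ⁻¹W) = ⟪X, W⟫` there. -/
def ChartFlat (g : PseudoRiemannianMetric (𝓡 4) ∞ (EuclideanSpace ℝ (Fin 4)) (TangentSpace (𝓡 4) : M → Type _))
    (p : M) (r : ℝ) : Prop :=
  Metric.closedBall (extChartAt (𝓡 4) p p) r ⊆ (extChartAt (𝓡 4) p).target ∧
    ∀ y ∈ Metric.closedBall (extChartAt (𝓡 4) p p) r, ∀ X W : EuclideanSpace ℝ (Fin 4),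
      g.val ((extChartAt (𝓡 4) p).symm y)
        (mfderiv 𝓘(ℝ, EuclideanSpace ℝ (Fin 4)) (𝓡 4) (extChartAt (𝓡 4) p).symm y X)
        (mfderiv 𝓘(ℝ, EuclideanSpace ℝ (Fin 4)) (𝓡 4) (extChartAt (𝓡 4) p).symm y W) = ⟪X, W⟫

/-- **Cone factor**: `Λ` is smooth and positive on `{p}ᶜ` and equals `c‖y − φ p‖^{−(c+1)}` in the chart
at `p` on the punctured closed ball of radius `r` — so that, where `g` is Euclidean in that chart,
`Λ²g = c²ρ^{−2c−2}(dρ² + ρ²g_{S³}) = ds² + c²s²g_{S³}` (`s = ρ^{−c}`), the exact cone of slope `c`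
over the round `S³`, with its large end at the puncture. -/
def ConeFactor (p : M) (Λ : M → ℝ) (c r : ℝ) : Prop :=
  ContMDiffOn (𝓡 4) 𝓘(ℝ, ℝ) ∞ Λ {p}ᶜ ∧ (∀ x, x ≠ p → 0 < Λ x) ∧
    ∀ y ∈ Metric.closedBall (extChartAt (𝓡 4) p p) r, y ≠ extChartAt (𝓡 4) p p →
      Λ ((extChartAt (𝓡 4) p).symm y) = c * ‖y - extChartAt (𝓡 4) p p‖ ^ (-(c + 1))

/-- **The entropy floor on `M` at level `L` for the blown-down metric `Λ²g`** (shape of the blow-up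
clause of the Schoen-gauge stubs): for every `τ > 0` and every smooth `w` vanishing near `p` with
`∫ (4πτ)⁻² w² Λ⁴ dV_g = 1`, `L ≤ ∫ [4τΛ⁻²|∇w|²_g − w² log w² − 4w²](4πτ)⁻²Λ⁴ dV_g`
(`= 𝒲(Λ²g, f, τ) − τ∫R u` at `u = (4πτ)⁻²w²`). -/
def FloorM [T3Space M] [MeasurableSpace M] [BorelSpace M]
    (g : PseudoRiemannianMetric (𝓡 4) ∞ (EuclideanSpace ℝ (Fin 4)) (TangentSpace (𝓡 4) : M → Type _))
    (hg : g.IsRiemannian) (p : M) (Λ : M → ℝ) (L : ℝ) : Prop :=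
  ∀ τ : ℝ, 0 < τ → ∀ w : M → ℝ, ContMDiff (𝓡 4) 𝓘(ℝ, ℝ) ∞ w → w =ᶠ[𝓝 p] 0 →
    ∫ x, (4 * Real.pi * τ) ^ (-(4 : ℝ) / 2) * (w x) ^ 2 * (Λ x) ^ 4
        ∂(riemannianMeasure (g.toContMDiffRiemannianMetric hg)) = 1 →
      L ≤ ∫ x, (4 * τ * ((Λ x)⁻¹ ^ 2 * g.gradSq w x) - (w x) ^ 2 * Real.log ((w x) ^ 2)
          - 4 * (w x) ^ 2) * ((4 * Real.pi * τ) ^ (-(4 : ℝ) / 2) * (Λ x) ^ 4)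
        ∂(riemannianMeasure (g.toContMDiffRiemannianMetric hg))

/-- **The crux's entropy clause at level `L`** for a metric `g` with Levi-Civita connection:
`∀ τ > 0 ∀ f smooth, ∫ (4πτ)⁻² e^{−f} dV = 1 → L ≤ 𝒲(g, f, τ)`. -/
def EntropyClause [T3Space M] [MeasurableSpace M] [BorelSpace M]
    (g : PseudoRiemannianMetric (𝓡 4) ∞ (EuclideanSpace ℝ (Fin 4)) (TangentSpace (𝓡 4) : M → Type _))
    [g.HasLeviCivita] (hg : g.IsRiemannian) (L : ℝ) : Prop :=
  ∀ τ : ℝ, 0 < τ → ∀ f : M → ℝ, ContMDiff (𝓡 4) 𝓘(ℝ, ℝ) ∞ f →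
    ∫ x, (4 * Real.pi * τ) ^ (-(4 : ℝ) / 2) * Real.exp (-f x)
        ∂(riemannianMeasure (g.toContMDiffRiemannianMetric hg)) = 1 →
      L ≤ ∫ x, (τ * (g.scalarCurvature x + g.gradSq f x) + f x - 4) *
          ((4 * Real.pi * τ) ^ (-(4 : ℝ) / 2) * Real.exp (-f x))
        ∂(riemannianMeasure (g.toContMDiffRiemannianMetric hg))

variable (P : Type) [TopologicalSpace P] [ChartedSpace (EuclideanSpace ℝ (Fin 4)) P]
  [IsManifold (𝓡 4) ∞ P] [T3Space P] [MeasurableSpace P] [BorelSpace P]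

/-- **The core is the blow-down `({p}ᶜ, Λ²g)`**: `ι : P → M` is a smooth injective immersion onto
`{p}ᶜ` with inverse `σ` smooth on `{p}ᶜ`, and `h = ι^*(Λ²g)` pointwise. -/
def CoreLink (p : M)
    (g : PseudoRiemannianMetric (𝓡 4) ∞ (EuclideanSpace ℝ (Fin 4)) (TangentSpace (𝓡 4) : M → Type _))
    (Λ : M → ℝ)
    (h : PseudoRiemannianMetric (𝓡 4) ∞ (EuclideanSpace ℝ (Fin 4)) (TangentSpace (𝓡 4) : P → Type _))
    (ι : P → M) (σ : M → P) : Prop :=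
  ContMDiff (𝓡 4) (𝓡 4) ∞ ι ∧ Injective ι ∧ (∀ q : P, Injective (mfderiv (𝓡 4) (𝓡 4) ι q)) ∧
    range ι = {p}ᶜ ∧ ContMDiffOn (𝓡 4) (𝓡 4) ∞ σ {p}ᶜ ∧ (∀ q : P, σ (ι q) = q) ∧
    (∀ x : M, x ≠ p → ι (σ x) = x) ∧
    ∀ (q : P) (v w : TangentSpace (𝓡 4) q),
      h.val q v w = Λ (ι q) ^ 2 * g.val (ι q) (mfderiv (𝓡 4) (𝓡 4) ι q v) (mfderiv (𝓡 4) (𝓡 4) ι q w)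

/-- **Fat core geometry**: `h` is complete (closed `h.edist`-balls compact), `Ric_h ≥ 0`, and has
asymptotic volume ratio `c³` at every point (`Vol B_r(x)/(π²r⁴/2) → c³`). -/
def CoreGeometry
    (h : PseudoRiemannianMetric (𝓡 4) ∞ (EuclideanSpace ℝ (Fin 4)) (TangentSpace (𝓡 4) : P → Type _))
    [h.HasLeviCivita] (hh : h.IsRiemannian) (c : ℝ) : Prop :=
  (∀ (x : P) (r : NNReal), IsCompact {y : P | h.edist hh x y ≤ r}) ∧
    (∀ (x : P) (X : TangentSpace (𝓡 4) x), 0 ≤ h.ricci x X X) ∧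
    ∀ x : P, Tendsto (fun r : ℝ ↦
      ((riemannianMeasure (h.toContMDiffRiemannianMetric hh))
        {y : P | h.edist hh x y ≤ ENNReal.ofReal r}).toReal / (Real.pi ^ 2 / 2 * r ^ 4))
      atTop (𝓝 (c ^ 3))

end Vocabulary

/-- **BKT Thm 1.1, Riemannian case, `p = 2`, `N = n = 4`** (Balogh–Kristály–Tripaldi, *Sharp log-Sobolev
inequalities in CD(0,N) spaces with applications*, arXiv:2210.15774, J. Funct. Anal. 286 (2024), Thm 1.1,
constant `𝓛_{2,4} = 1/(2πe)`), as printed: on a complete connected Riemannian 4-manifold with `Ric ≥ 0`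
and asymptotic volume ratio `θ > 0`, every smooth compactly supported `u` with `∫ u² dV = 1` satisfies
the printed `∫ u² log u² dV ≤ 2 log ((2πe)⁻¹ θ^{−1/2} ∫ |∇u|² dV)`, stated here as the equivalent
SCALE FAMILY of linear inequalities `∀ τ > 0, ∫ u² log u² dV ≤ 4τ ∫|∇u|² dV − log θ − 2 log(4πτ) − 4`
(`log Y = min_{λ>0} (λY − 1 − log λ)` at `λ = 4πeτ√θ`; this is the form free of `log` of an integral,
and the form Perelman's `𝒲` consumes: `𝒲 − τ∫Ru ≥ log θ`). A complete Riemannian manifold with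
`Ric ≥ 0` is a `CD(0,n)` space for its volume measure and smooth compactly supported functions are in
`W^{1,2}` with `|∇u|` the Riemannian gradient norm, so this is a special case of the printed theorem.
Stated INLINE (this file is not importable); a Literature named-fact candidate
`[file Geometry/Riemannian/LogSobolevAVR]`. -/
def BKTLogSobolevAVRFour : Prop :=
  ∀ (P : Type) [TopologicalSpace P] [T2Space P] [SecondCountableTopology P]
    [ChartedSpace (EuclideanSpace ℝ (Fin 4)) P] [IsManifold (𝓡 4) ∞ P] [ConnectedSpace P]
    [T3Space P] [MeasurableSpace P] [BorelSpace P]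
    (h : PseudoRiemannianMetric (𝓡 4) ∞ (EuclideanSpace ℝ (Fin 4)) (TangentSpace (𝓡 4) : P → Type _))
    [h.HasLeviCivita] (hh : h.IsRiemannian) (θ : ℝ),
    (∀ (x : P) (r : NNReal), IsCompact {y : P | h.edist hh x y ≤ r}) →
    (∀ (x : P) (X : TangentSpace (𝓡 4) x), 0 ≤ h.ricci x X X) → 0 < θ →
    (∀ x : P, Tendsto (fun r : ℝ ↦
      ((riemannianMeasure (h.toContMDiffRiemannianMetric hh))
        {y : P | h.edist hh x y ≤ ENNReal.ofReal r}).toReal / (Real.pi ^ 2 / 2 * r ^ 4))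
      atTop (𝓝 θ)) →
    ∀ u : P → ℝ, ContMDiff (𝓡 4) 𝓘(ℝ, ℝ) ∞ u → HasCompactSupport u →
      ∫ x, (u x) ^ 2 ∂(riemannianMeasure (h.toContMDiffRiemannianMetric hh)) = 1 →
      ∀ τ : ℝ, 0 < τ →
        ∫ x, (u x) ^ 2 * Real.log ((u x) ^ 2) ∂(riemannianMeasure (h.toContMDiffRiemannianMetric hh)) ≤
          4 * τ * ∫ x, h.gradSq u x ∂(riemannianMeasure (h.toContMDiffRiemannianMetric hh))
            - Real.log θ - 2 * Real.log (4 * Real.pi * τ) - 4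

/-! ## The statements of the line as named `Prop`s -/

/-- **T — conformal fat cone core existence** (the transferred crux C⁺ in the conformal cone gauge;
SPC4-hard for exotic `M`, TRUE on `S⁴` with `c = 1`): every closed smooth homotopy 4-sphere carries a
Riemannian metric `g` (Levi-Civita) Euclidean in the atlas chart at some `p`, a cone factor `Λ` of
slope `c` there, and a complete `Ric ≥ 0` core `(P, h) = ({p}ᶜ, Λ²g)` (via an explicit inverse pair
`ι, σ`) of asymptotic volume ratio `c³ > Θ(S³×ℝ) = 2√π e^{−3/2}`, `0 < c ≤ 1`. -/
def ConeCoreExistence : Prop :=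
  ∀ (M : Type) [TopologicalSpace M] [T2Space M] [SecondCountableTopology M]
    [ChartedSpace (EuclideanSpace ℝ (Fin 4)) M] [IsManifold (𝓡 4) ∞ M] [CompactSpace M]
    [T3Space M] [MeasurableSpace M] [BorelSpace M],
    M ≃ₕ Metric.sphere (0 : EuclideanSpace ℝ (Fin 5)) 1 →
    ∃ g : PseudoRiemannianMetric (𝓡 4) ∞ (EuclideanSpace ℝ (Fin 4)) (TangentSpace (𝓡 4) : M → Type _),
    ∃ _ : g.HasLeviCivita, ∃ _ : g.IsRiemannian, ∃ (p : M) (r : ℝ) (Λ : M → ℝ) (c : ℝ)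
      (P : Type) (_ : TopologicalSpace P) (_ : T2Space P) (_ : SecondCountableTopology P)
      (_ : ChartedSpace (EuclideanSpace ℝ (Fin 4)) P) (_ : IsManifold (𝓡 4) ∞ P) (_ : ConnectedSpace P)
      (_ : NoncompactSpace P) (_ : T3Space P) (_ : MeasurableSpace P) (_ : BorelSpace P)
      (h : PseudoRiemannianMetric (𝓡 4) ∞ (EuclideanSpace ℝ (Fin 4)) (TangentSpace (𝓡 4) : P → Type _))
      (_ : h.HasLeviCivita) (hh : h.IsRiemannian) (ι : P → M) (σ : M → P),
      ChartFlat M g p r ∧ ConeFactor M p Λ c r ∧ CoreLink M P p g Λ h ι σ ∧ CoreGeometry P h hh c ∧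
        (0 < r ∧ 0 < c ∧ c ≤ 1) ∧ 2 * Real.sqrt Real.pi * Real.exp (-(3 : ℝ) / 2) < c ^ 3

/-- **F — the floor bridge** (BKT ⇒ floor on `M`): for data `(g, Λ, P, h, ι, σ)` with `Λ` smooth and
positive off `p`, `CoreLink` and `CoreGeometry` at slope `c > 0`, the printed BKT inequality for
`(P, h)` yields the scale-uniform floor `FloorM g Λ (3 log c)` on `M` (scale optimisation
`log Y = min_λ (λY − 1 − log λ)` + transport of test functions vanishing near `p` along `ι`) and
`R_{Λ²g} ≥ 0` off `p` in the form `0 ≤ R_g Λ − 6 Δ_g Λ` (naturality of `Ric` under `ι`, trace, and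
the conformal law `R_{Λ²g} = Λ⁻³(R_gΛ − 6Δ_gΛ)`). Closable (published theorem + transport). -/
def FloorBridge : Prop :=
  BKTLogSobolevAVRFour →
  ∀ (M : Type) [TopologicalSpace M] [T2Space M] [SecondCountableTopology M]
    [ChartedSpace (EuclideanSpace ℝ (Fin 4)) M] [IsManifold (𝓡 4) ∞ M] [CompactSpace M]
    [T3Space M] [MeasurableSpace M] [BorelSpace M]
    (g : PseudoRiemannianMetric (𝓡 4) ∞ (EuclideanSpace ℝ (Fin 4)) (TangentSpace (𝓡 4) : M → Type _))
    [g.HasLeviCivita] (hg : g.IsRiemannian) (p : M) (Λ : M → ℝ) (c : ℝ)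
    (P : Type) [TopologicalSpace P] [T2Space P] [SecondCountableTopology P]
    [ChartedSpace (EuclideanSpace ℝ (Fin 4)) P] [IsManifold (𝓡 4) ∞ P] [ConnectedSpace P]
    [NoncompactSpace P] [T3Space P] [MeasurableSpace P] [BorelSpace P]
    (h : PseudoRiemannianMetric (𝓡 4) ∞ (EuclideanSpace ℝ (Fin 4)) (TangentSpace (𝓡 4) : P → Type _))
    [h.HasLeviCivita] (hh : h.IsRiemannian) (ι : P → M) (σ : M → P),
    ContMDiffOn (𝓡 4) 𝓘(ℝ, ℝ) ∞ Λ {p}ᶜ → (∀ x, x ≠ p → 0 < Λ x) → 0 < c →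
    CoreLink M P p g Λ h ι σ → CoreGeometry P h hh c →
    FloorM M g hg p Λ (3 * Real.log c) ∧
      ∀ x, x ≠ p → 0 ≤ g.scalarCurvature x * Λ x - 6 * g.dalembertian Λ x

/-- **K — cone capping, the closing lemma** (per manifold, ANY closed `M`): a metric Euclidean in the
chart at `p` on `closedBall _ r`, a cone factor `Λ` of slope `c ∈ (0,1]` there with `R_{Λ²g} ≥ 0` off
`p` and the floor `FloorM g Λ (3 log c)` (the level BKT delivers for AVR `c³` — a higher level would contradict the
sharpness of BKT, so no generality is lost), can be capped: for every `ε > 0` there is a CONFORMAL metric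
`G = Φ²g` (`Φ = Λ` off a small chart ball, radial `e^{w(ρ)}` inside: exact cone → logarithmically slow
opening → huge round cap in stereographic presentation) with Levi-Civita connection, `R_G ≥ 0`
everywhere, `R_G > 0` somewhere, and the crux's clause at level `min(3 log c, log 6 − 2) − ε`.
(Localisation of `𝒲` with `Σχᵢ² = 1` cut-offs — IMS + Jensen; cut-off cost charged to the Dirichlet
form through the conformally invariant `∫|∇χ|⁴` and the Yamabe–Sobolev inequality of `[g]`; cap side =
RoundBound through the flat chart; opening annuli = exact cones of slopes `c' ∈ [c, 1]`, each a piece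
of a complete smoothed cone of AVR `c'³ ≥ c³` — BKT again, whence the inline BKT text is the FIRST hypothesis of the
stub, exactly as for the bridge; core side = the hypothesis `FloorM`.) The line's new analysis; lead's stub. -/
def ConeCapping : Prop :=
  BKTLogSobolevAVRFour →
  ∀ (M : Type) [TopologicalSpace M] [T2Space M] [SecondCountableTopology M]
    [ChartedSpace (EuclideanSpace ℝ (Fin 4)) M] [IsManifold (𝓡 4) ∞ M] [CompactSpace M]
    [ConnectedSpace M] [T3Space M] [MeasurableSpace M] [BorelSpace M]
    (g : PseudoRiemannianMetric (𝓡 4) ∞ (EuclideanSpace ℝ (Fin 4)) (TangentSpace (𝓡 4) : M → Type _))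
    [g.HasLeviCivita] (hg : g.IsRiemannian) (p : M) (r : ℝ) (Λ : M → ℝ) (c : ℝ),
    ChartFlat M g p r → ConeFactor M p Λ c r → 0 < r → 0 < c → c ≤ 1 →
    (∀ x, x ≠ p → 0 ≤ g.scalarCurvature x * Λ x - 6 * g.dalembertian Λ x) →
    FloorM M g hg p Λ (3 * Real.log c) →
    ∀ ε : ℝ, 0 < ε →
      ∃ G : PseudoRiemannianMetric (𝓡 4) ∞ (EuclideanSpace ℝ (Fin 4)) (TangentSpace (𝓡 4) : M → Type _),
      ∃ _ : G.HasLeviCivita, ∃ hG : G.IsRiemannian,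
        (∀ x : M, 0 ≤ G.scalarCurvature x) ∧ (∃ x : M, 0 < G.scalarCurvature x) ∧
          EntropyClause M G hG (min (3 * Real.log c) (Real.log 6 - 2) - ε)

/-- **U — positivity upgrade with an explicit entropy loss** (common to every existence line of this
crux; the card's "same level" version is not what a conformal perturbation gives uniformly in the
scale, so the loss `ε > 0` is explicit): on a closed 4-manifold, a Riemannian `G` (Levi-Civita) with
`R ≥ 0`, `R > 0` somewhere and the clause at level `L` admits, for every `ε > 0`, a metric `G'` with
`R > 0` EVERYWHERE and the clause at level `L − ε`. (`G' = (1 + tφ)²G` with `φ > 0` the ground state of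
`−Δ_G + R_G/6`, eigenvalue `λ = ∫R_Gφ/(6∫φ) > 0`, so `R_{G'} = (R + 6tλφ)(1 + tφ)⁻³ > 0`; the clause
moves by `O(t)` uniformly in `τ`: the factor's deviation from `1` is absorbed by a scale shift, its
gradient by the Yamabe–Sobolev inequality of `[G]` — which holds because `[G] ∋ G` has `R ≥ 0`,
`R ≢ 0`.) -/
def ScalarPositiveUpgrade : Prop :=
  ∀ (M : Type) [TopologicalSpace M] [T2Space M] [SecondCountableTopology M]
    [ChartedSpace (EuclideanSpace ℝ (Fin 4)) M] [IsManifold (𝓡 4) ∞ M] [CompactSpace M]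
    [ConnectedSpace M] [T3Space M] [MeasurableSpace M] [BorelSpace M]
    (G : PseudoRiemannianMetric (𝓡 4) ∞ (EuclideanSpace ℝ (Fin 4)) (TangentSpace (𝓡 4) : M → Type _))
    [G.HasLeviCivita] (hG : G.IsRiemannian) (L : ℝ),
    (∀ x : M, 0 ≤ G.scalarCurvature x) → (∃ x : M, 0 < G.scalarCurvature x) →
    EntropyClause M G hG L →
    ∀ ε : ℝ, 0 < ε →
      ∃ G' : PseudoRiemannianMetric (𝓡 4) ∞ (EuclideanSpace ℝ (Fin 4)) (TangentSpace (𝓡 4) : M → Type _),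
      ∃ _ : G'.HasLeviCivita, ∃ hG' : G'.IsRiemannian,
        (∀ x : M, 0 < G'.scalarCurvature x) ∧ EntropyClause M G' hG' (L - ε)

/-! ## The registered stubs (`sorry` lives only here; statements = the named `Prop`s UNFOLDED, so each
registered signature is self-contained) -/

/-- **STUB B · `stub_bktLogSobolevAVRFour`** — `BKTLogSobolevAVRFour` verbatim: Balogh–Kristály–Tripaldi,
arXiv:2210.15774 (J. Funct. Anal. 2024) Thm 1.1, Riemannian case, `p = 2`, `N = 4`, scale-family form.
A PUBLISHED theorem (named-fact stub: closes by `exact` from a Literature `_holds`; XL as a Lean target —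
Balogh–Kristály isoperimetry on `CD(0,N)` + Pólya–Szegő rearrangement + the 1-d weighted log-Sobolev
inequality on the model cone). Proposed as the Literature named fact
`Literature.Geometry.Riemannian.sharpLogSobolevAVR_four` (`Literature/Geometry/Riemannian/SharpLogSobolevAVR.lean`,
p132456 ACCEPTED, commit f7673f1507b8): this stub IS that fact verbatim (`bkt_stub_iff_fact` below, by `Iff.rfl`), so it
closes by `exact Literature.Geometry.Riemannian.sharpLogSobolevAVR_four_holds` the day the fact is proved; until
then the line's composition is CONDITIONAL on a Literature named fact. -/
theorem stub_bktLogSobolevAVRFour :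
    ∀ (P : Type) [TopologicalSpace P] [T2Space P] [SecondCountableTopology P]
    [ChartedSpace (EuclideanSpace ℝ (Fin 4)) P] [IsManifold (𝓡 4) ∞ P] [ConnectedSpace P]
    [T3Space P] [MeasurableSpace P] [BorelSpace P]
    (h : PseudoRiemannianMetric (𝓡 4) ∞ (EuclideanSpace ℝ (Fin 4)) (TangentSpace (𝓡 4) : P → Type _))
    [h.HasLeviCivita] (hh : h.IsRiemannian) (θ : ℝ),
    (∀ (x : P) (r : NNReal), IsCompact {y : P | h.edist hh x y ≤ r}) →
    (∀ (x : P) (X : TangentSpace (𝓡 4) x), 0 ≤ h.ricci x X X) → 0 < θ →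
    (∀ x : P, Tendsto (fun r : ℝ ↦
      ((riemannianMeasure (h.toContMDiffRiemannianMetric hh))
        {y : P | h.edist hh x y ≤ ENNReal.ofReal r}).toReal / (Real.pi ^ 2 / 2 * r ^ 4))
      atTop (𝓝 θ)) →
    ∀ u : P → ℝ, ContMDiff (𝓡 4) 𝓘(ℝ, ℝ) ∞ u → HasCompactSupport u →
      ∫ x, (u x) ^ 2 ∂(riemannianMeasure (h.toContMDiffRiemannianMetric hh)) = 1 →
      ∀ τ : ℝ, 0 < τ →
        ∫ x, (u x) ^ 2 * Real.log ((u x) ^ 2) ∂(riemannianMeasure (h.toContMDiffRiemannianMetric hh)) ≤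
          4 * τ * ∫ x, h.gradSq u x ∂(riemannianMeasure (h.toContMDiffRiemannianMetric hh))
            - Real.log θ - 2 * Real.log (4 * Real.pi * τ) - 4 := by
  sorry

/-- **STUB T · `stub_coneCoreExistence`** — `ConeCoreExistence` verbatim (transfer stub; SPC4-hard,
never proved here for exotic `M`; the `S⁴` witness is a de-risking target). -/
theorem stub_coneCoreExistence :
    ∀ (M : Type) [TopologicalSpace M] [T2Space M] [SecondCountableTopology M]
    [ChartedSpace (EuclideanSpace ℝ (Fin 4)) M] [IsManifold (𝓡 4) ∞ M] [CompactSpace M]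
    [T3Space M] [MeasurableSpace M] [BorelSpace M],
    M ≃ₕ Metric.sphere (0 : EuclideanSpace ℝ (Fin 5)) 1 →
    ∃ g : PseudoRiemannianMetric (𝓡 4) ∞ (EuclideanSpace ℝ (Fin 4)) (TangentSpace (𝓡 4) : M → Type _),
    ∃ _ : g.HasLeviCivita, ∃ _ : g.IsRiemannian, ∃ (p : M) (r : ℝ) (Λ : M → ℝ) (c : ℝ)
      (P : Type) (_ : TopologicalSpace P) (_ : T2Space P) (_ : SecondCountableTopology P)
      (_ : ChartedSpace (EuclideanSpace ℝ (Fin 4)) P) (_ : IsManifold (𝓡 4) ∞ P) (_ : ConnectedSpace P)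
      (_ : NoncompactSpace P) (_ : T3Space P) (_ : MeasurableSpace P) (_ : BorelSpace P)
      (h : PseudoRiemannianMetric (𝓡 4) ∞ (EuclideanSpace ℝ (Fin 4)) (TangentSpace (𝓡 4) : P → Type _))
      (_ : h.HasLeviCivita) (hh : h.IsRiemannian) (ι : P → M) (σ : M → P),
      (Metric.closedBall (extChartAt (𝓡 4) p p) r ⊆ (extChartAt (𝓡 4) p).target ∧
        ∀ y ∈ Metric.closedBall (extChartAt (𝓡 4) p p) r, ∀ X W : EuclideanSpace ℝ (Fin 4),
          g.val ((extChartAt (𝓡 4) p).symm y)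
            (mfderiv 𝓘(ℝ, EuclideanSpace ℝ (Fin 4)) (𝓡 4) (extChartAt (𝓡 4) p).symm y X)
            (mfderiv 𝓘(ℝ, EuclideanSpace ℝ (Fin 4)) (𝓡 4) (extChartAt (𝓡 4) p).symm y W) = ⟪X, W⟫) ∧
      (ContMDiffOn (𝓡 4) 𝓘(ℝ, ℝ) ∞ Λ {p}ᶜ ∧ (∀ x, x ≠ p → 0 < Λ x) ∧
        ∀ y ∈ Metric.closedBall (extChartAt (𝓡 4) p p) r, y ≠ extChartAt (𝓡 4) p p →
          Λ ((extChartAt (𝓡 4) p).symm y) = c * ‖y - extChartAt (𝓡 4) p p‖ ^ (-(c + 1))) ∧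
      (ContMDiff (𝓡 4) (𝓡 4) ∞ ι ∧ Injective ι ∧ (∀ q : P, Injective (mfderiv (𝓡 4) (𝓡 4) ι q)) ∧
        range ι = {p}ᶜ ∧ ContMDiffOn (𝓡 4) (𝓡 4) ∞ σ {p}ᶜ ∧ (∀ q : P, σ (ι q) = q) ∧
        (∀ x : M, x ≠ p → ι (σ x) = x) ∧
        ∀ (q : P) (v w : TangentSpace (𝓡 4) q),
          h.val q v w = Λ (ι q) ^ 2 *
            g.val (ι q) (mfderiv (𝓡 4) (𝓡 4) ι q v) (mfderiv (𝓡 4) (𝓡 4) ι q w)) ∧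
      ((∀ (x : P) (r : NNReal), IsCompact {y : P | h.edist hh x y ≤ r}) ∧
        (∀ (x : P) (X : TangentSpace (𝓡 4) x), 0 ≤ h.ricci x X X) ∧
        ∀ x : P, Tendsto (fun r : ℝ ↦
          ((riemannianMeasure (h.toContMDiffRiemannianMetric hh))
            {y : P | h.edist hh x y ≤ ENNReal.ofReal r}).toReal / (Real.pi ^ 2 / 2 * r ^ 4))
          atTop (𝓝 (c ^ 3))) ∧
      (0 < r ∧ 0 < c ∧ c ≤ 1) ∧ 2 * Real.sqrt Real.pi * Real.exp (-(3 : ℝ) / 2) < c ^ 3 := by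
  sorry

/-- **STUB F · `stub_floorBridge`** — `FloorBridge` verbatim: BKT Thm 1.1 (inline) ⇒ the floor on `M`
and `R_{Λ²g} ≥ 0` off `p`. CLOSED: landed p129780 (aux transport helper p129523). -/
theorem stub_floorBridge :
    (∀ (P : Type) [TopologicalSpace P] [T2Space P] [SecondCountableTopology P]
      [ChartedSpace (EuclideanSpace ℝ (Fin 4)) P] [IsManifold (𝓡 4) ∞ P] [ConnectedSpace P]
      [T3Space P] [MeasurableSpace P] [BorelSpace P]
      (h : PseudoRiemannianMetric (𝓡 4) ∞ (EuclideanSpace ℝ (Fin 4)) (TangentSpace (𝓡 4) : P → Type _))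
      [h.HasLeviCivita] (hh : h.IsRiemannian) (θ : ℝ),
      (∀ (x : P) (r : NNReal), IsCompact {y : P | h.edist hh x y ≤ r}) →
      (∀ (x : P) (X : TangentSpace (𝓡 4) x), 0 ≤ h.ricci x X X) → 0 < θ →
      (∀ x : P, Tendsto (fun r : ℝ ↦
        ((riemannianMeasure (h.toContMDiffRiemannianMetric hh))
          {y : P | h.edist hh x y ≤ ENNReal.ofReal r}).toReal / (Real.pi ^ 2 / 2 * r ^ 4))
        atTop (𝓝 θ)) →
      ∀ u : P → ℝ, ContMDiff (𝓡 4) 𝓘(ℝ, ℝ) ∞ u → HasCompactSupport u →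
        ∫ x, (u x) ^ 2 ∂(riemannianMeasure (h.toContMDiffRiemannianMetric hh)) = 1 →
        ∀ τ : ℝ, 0 < τ →
          ∫ x, (u x) ^ 2 * Real.log ((u x) ^ 2) ∂(riemannianMeasure (h.toContMDiffRiemannianMetric hh)) ≤
            4 * τ * ∫ x, h.gradSq u x ∂(riemannianMeasure (h.toContMDiffRiemannianMetric hh))
              - Real.log θ - 2 * Real.log (4 * Real.pi * τ) - 4) →
    ∀ (M : Type) [TopologicalSpace M] [T2Space M] [SecondCountableTopology M]
    [ChartedSpace (EuclideanSpace ℝ (Fin 4)) M] [IsManifold (𝓡 4) ∞ M] [CompactSpace M]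
    [T3Space M] [MeasurableSpace M] [BorelSpace M]
    (g : PseudoRiemannianMetric (𝓡 4) ∞ (EuclideanSpace ℝ (Fin 4)) (TangentSpace (𝓡 4) : M → Type _))
    [g.HasLeviCivita] (hg : g.IsRiemannian) (p : M) (Λ : M → ℝ) (c : ℝ)
    (P : Type) [TopologicalSpace P] [T2Space P] [SecondCountableTopology P]
    [ChartedSpace (EuclideanSpace ℝ (Fin 4)) P] [IsManifold (𝓡 4) ∞ P] [ConnectedSpace P]
    [NoncompactSpace P] [T3Space P] [MeasurableSpace P] [BorelSpace P]
    (h : PseudoRiemannianMetric (𝓡 4) ∞ (EuclideanSpace ℝ (Fin 4)) (TangentSpace (𝓡 4) : P → Type _))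
    [h.HasLeviCivita] (hh : h.IsRiemannian) (ι : P → M) (σ : M → P),
    ContMDiffOn (𝓡 4) 𝓘(ℝ, ℝ) ∞ Λ {p}ᶜ → (∀ x, x ≠ p → 0 < Λ x) → 0 < c →
    (ContMDiff (𝓡 4) (𝓡 4) ∞ ι ∧ Injective ι ∧ (∀ q : P, Injective (mfderiv (𝓡 4) (𝓡 4) ι q)) ∧
      range ι = {p}ᶜ ∧ ContMDiffOn (𝓡 4) (𝓡 4) ∞ σ {p}ᶜ ∧ (∀ q : P, σ (ι q) = q) ∧
      (∀ x : M, x ≠ p → ι (σ x) = x) ∧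
      ∀ (q : P) (v w : TangentSpace (𝓡 4) q),
        h.val q v w = Λ (ι q) ^ 2 *
          g.val (ι q) (mfderiv (𝓡 4) (𝓡 4) ι q v) (mfderiv (𝓡 4) (𝓡 4) ι q w)) →
    ((∀ (x : P) (r : NNReal), IsCompact {y : P | h.edist hh x y ≤ r}) ∧
      (∀ (x : P) (X : TangentSpace (𝓡 4) x), 0 ≤ h.ricci x X X) ∧
      ∀ x : P, Tendsto (fun r : ℝ ↦
        ((riemannianMeasure (h.toContMDiffRiemannianMetric hh))
          {y : P | h.edist hh x y ≤ ENNReal.ofReal r}).toReal / (Real.pi ^ 2 / 2 * r ^ 4))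
        atTop (𝓝 (c ^ 3))) →
    (∀ τ : ℝ, 0 < τ → ∀ w : M → ℝ, ContMDiff (𝓡 4) 𝓘(ℝ, ℝ) ∞ w → w =ᶠ[𝓝 p] 0 →
      ∫ x, (4 * Real.pi * τ) ^ (-(4 : ℝ) / 2) * (w x) ^ 2 * (Λ x) ^ 4
          ∂(riemannianMeasure (g.toContMDiffRiemannianMetric hg)) = 1 →
        3 * Real.log c ≤ ∫ x, (4 * τ * ((Λ x)⁻¹ ^ 2 * g.gradSq w x) - (w x) ^ 2 * Real.log ((w x) ^ 2)
            - 4 * (w x) ^ 2) * ((4 * Real.pi * τ) ^ (-(4 : ℝ) / 2) * (Λ x) ^ 4)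
          ∂(riemannianMeasure (g.toContMDiffRiemannianMetric hg))) ∧
      ∀ x, x ≠ p → 0 ≤ g.scalarCurvature x * Λ x - 6 * g.dalembertian Λ x :=
  -- LANDED p129780 (wave 1): `Theorems/EntropyRungSubcylindricalExistenceFloorBridge.lean`
  Summit.SmoothPoincare4.SmoothPoincare4.Theorems.stub_floorBridge

/-- **STUB K · `stub_coneCapping`** — `ConeCapping` verbatim (the closing lemma, per manifold; lead). CLOSED: landed as
`Theorems/EntropyRungSubcylindricalExistenceConeCapping.lean` (17 helper files). -/
theorem stub_coneCapping :
    (∀ (P : Type) [TopologicalSpace P] [T2Space P] [SecondCountableTopology P]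
      [ChartedSpace (EuclideanSpace ℝ (Fin 4)) P] [IsManifold (𝓡 4) ∞ P] [ConnectedSpace P]
      [T3Space P] [MeasurableSpace P] [BorelSpace P]
      (h : PseudoRiemannianMetric (𝓡 4) ∞ (EuclideanSpace ℝ (Fin 4)) (TangentSpace (𝓡 4) : P → Type _))
      [h.HasLeviCivita] (hh : h.IsRiemannian) (θ : ℝ),
      (∀ (x : P) (r : NNReal), IsCompact {y : P | h.edist hh x y ≤ r}) →
      (∀ (x : P) (X : TangentSpace (𝓡 4) x), 0 ≤ h.ricci x X X) → 0 < θ →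
      (∀ x : P, Tendsto (fun r : ℝ ↦
        ((riemannianMeasure (h.toContMDiffRiemannianMetric hh))
          {y : P | h.edist hh x y ≤ ENNReal.ofReal r}).toReal / (Real.pi ^ 2 / 2 * r ^ 4))
        atTop (𝓝 θ)) →
      ∀ u : P → ℝ, ContMDiff (𝓡 4) 𝓘(ℝ, ℝ) ∞ u → HasCompactSupport u →
        ∫ x, (u x) ^ 2 ∂(riemannianMeasure (h.toContMDiffRiemannianMetric hh)) = 1 →
        ∀ τ : ℝ, 0 < τ →
          ∫ x, (u x) ^ 2 * Real.log ((u x) ^ 2) ∂(riemannianMeasure (h.toContMDiffRiemannianMetric hh)) ≤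
            4 * τ * ∫ x, h.gradSq u x ∂(riemannianMeasure (h.toContMDiffRiemannianMetric hh))
              - Real.log θ - 2 * Real.log (4 * Real.pi * τ) - 4) →
    ∀ (M : Type) [TopologicalSpace M] [T2Space M] [SecondCountableTopology M]
    [ChartedSpace (EuclideanSpace ℝ (Fin 4)) M] [IsManifold (𝓡 4) ∞ M] [CompactSpace M]
    [ConnectedSpace M] [T3Space M] [MeasurableSpace M] [BorelSpace M]
    (g : PseudoRiemannianMetric (𝓡 4) ∞ (EuclideanSpace ℝ (Fin 4)) (TangentSpace (𝓡 4) : M → Type _))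
    [g.HasLeviCivita] (hg : g.IsRiemannian) (p : M) (r : ℝ) (Λ : M → ℝ) (c : ℝ),
    (Metric.closedBall (extChartAt (𝓡 4) p p) r ⊆ (extChartAt (𝓡 4) p).target ∧
      ∀ y ∈ Metric.closedBall (extChartAt (𝓡 4) p p) r, ∀ X W : EuclideanSpace ℝ (Fin 4),
        g.val ((extChartAt (𝓡 4) p).symm y)
          (mfderiv 𝓘(ℝ, EuclideanSpace ℝ (Fin 4)) (𝓡 4) (extChartAt (𝓡 4) p).symm y X)
          (mfderiv 𝓘(ℝ, EuclideanSpace ℝ (Fin 4)) (𝓡 4) (extChartAt (𝓡 4) p).symm y W) = ⟪X, W⟫) →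
    (ContMDiffOn (𝓡 4) 𝓘(ℝ, ℝ) ∞ Λ {p}ᶜ ∧ (∀ x, x ≠ p → 0 < Λ x) ∧
      ∀ y ∈ Metric.closedBall (extChartAt (𝓡 4) p p) r, y ≠ extChartAt (𝓡 4) p p →
        Λ ((extChartAt (𝓡 4) p).symm y) = c * ‖y - extChartAt (𝓡 4) p p‖ ^ (-(c + 1))) →
    0 < r → 0 < c → c ≤ 1 →
    (∀ x, x ≠ p → 0 ≤ g.scalarCurvature x * Λ x - 6 * g.dalembertian Λ x) →
    (∀ τ : ℝ, 0 < τ → ∀ w : M → ℝ, ContMDiff (𝓡 4) 𝓘(ℝ, ℝ) ∞ w → w =ᶠ[𝓝 p] 0 →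
      ∫ x, (4 * Real.pi * τ) ^ (-(4 : ℝ) / 2) * (w x) ^ 2 * (Λ x) ^ 4
          ∂(riemannianMeasure (g.toContMDiffRiemannianMetric hg)) = 1 →
        3 * Real.log c ≤ ∫ x, (4 * τ * ((Λ x)⁻¹ ^ 2 * g.gradSq w x) - (w x) ^ 2 * Real.log ((w x) ^ 2)
            - 4 * (w x) ^ 2) * ((4 * Real.pi * τ) ^ (-(4 : ℝ) / 2) * (Λ x) ^ 4)
          ∂(riemannianMeasure (g.toContMDiffRiemannianMetric hg))) →
    ∀ ε : ℝ, 0 < ε →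
      ∃ G : PseudoRiemannianMetric (𝓡 4) ∞ (EuclideanSpace ℝ (Fin 4)) (TangentSpace (𝓡 4) : M → Type _),
      ∃ _ : G.HasLeviCivita, ∃ hG : G.IsRiemannian,
        (∀ x : M, 0 ≤ G.scalarCurvature x) ∧ (∃ x : M, 0 < G.scalarCurvature x) ∧
        ∀ τ : ℝ, 0 < τ → ∀ f : M → ℝ, ContMDiff (𝓡 4) 𝓘(ℝ, ℝ) ∞ f →
          ∫ x, (4 * Real.pi * τ) ^ (-(4 : ℝ) / 2) * Real.exp (-f x)
              ∂(riemannianMeasure (G.toContMDiffRiemannianMetric hG)) = 1 →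
            min (3 * Real.log c) (Real.log 6 - 2) - ε ≤
              ∫ x, (τ * (G.scalarCurvature x + G.gradSq f x) + f x - 4) *
                ((4 * Real.pi * τ) ^ (-(4 : ℝ) / 2) * Real.exp (-f x))
                ∂(riemannianMeasure (G.toContMDiffRiemannianMetric hG)) :=
  Summit.SmoothPoincare4.SmoothPoincare4.Theorems.stub_coneCapping

/-- **STUB U · `stub_scalarPositiveUpgrade`** — `ScalarPositiveUpgrade` verbatim (`R ≥ 0, R ≢ 0, ν ≥ L
⇒ R > 0, ν ≥ L − ε`; conformal nudge by the ground state of the conformal Laplacian). CLOSED: landed p130772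
(aux p130244 ground state, p130657 factor). -/
theorem stub_scalarPositiveUpgrade :
    ∀ (M : Type) [TopologicalSpace M] [T2Space M] [SecondCountableTopology M]
    [ChartedSpace (EuclideanSpace ℝ (Fin 4)) M] [IsManifold (𝓡 4) ∞ M] [CompactSpace M]
    [ConnectedSpace M] [T3Space M] [MeasurableSpace M] [BorelSpace M]
    (G : PseudoRiemannianMetric (𝓡 4) ∞ (EuclideanSpace ℝ (Fin 4)) (TangentSpace (𝓡 4) : M → Type _))
    [G.HasLeviCivita] (hG : G.IsRiemannian) (L : ℝ),
    (∀ x : M, 0 ≤ G.scalarCurvature x) → (∃ x : M, 0 < G.scalarCurvature x) →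
    (∀ τ : ℝ, 0 < τ → ∀ f : M → ℝ, ContMDiff (𝓡 4) 𝓘(ℝ, ℝ) ∞ f →
      ∫ x, (4 * Real.pi * τ) ^ (-(4 : ℝ) / 2) * Real.exp (-f x)
          ∂(riemannianMeasure (G.toContMDiffRiemannianMetric hG)) = 1 →
        L ≤ ∫ x, (τ * (G.scalarCurvature x + G.gradSq f x) + f x - 4) *
          ((4 * Real.pi * τ) ^ (-(4 : ℝ) / 2) * Real.exp (-f x))
          ∂(riemannianMeasure (G.toContMDiffRiemannianMetric hG))) →
    ∀ ε : ℝ, 0 < ε →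
      ∃ G' : PseudoRiemannianMetric (𝓡 4) ∞ (EuclideanSpace ℝ (Fin 4)) (TangentSpace (𝓡 4) : M → Type _),
      ∃ _ : G'.HasLeviCivita, ∃ hG' : G'.IsRiemannian,
        (∀ x : M, 0 < G'.scalarCurvature x) ∧
        ∀ τ : ℝ, 0 < τ → ∀ f : M → ℝ, ContMDiff (𝓡 4) 𝓘(ℝ, ℝ) ∞ f →
          ∫ x, (4 * Real.pi * τ) ^ (-(4 : ℝ) / 2) * Real.exp (-f x)
              ∂(riemannianMeasure (G'.toContMDiffRiemannianMetric hG')) = 1 →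
            L - ε ≤ ∫ x, (τ * (G'.scalarCurvature x + G'.gradSq f x) + f x - 4) *
              ((4 * Real.pi * τ) ^ (-(4 : ℝ) / 2) * Real.exp (-f x))
              ∂(riemannianMeasure (G'.toContMDiffRiemannianMetric hG')) :=
  -- LANDED p130772 (wave 1): `Theorems/EntropyRungSubcylindricalExistenceScalarPositiveUpgrade.lean`
  Summit.SmoothPoincare4.SmoothPoincare4.Theorems.stub_scalarPositiveUpgrade

/-! ### Consistency: each named statement IS its registered stub (definitionally) -/

theorem bktLogSobolevAVRFour_holds : BKTLogSobolevAVRFour := stub_bktLogSobolevAVRFour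

/-- The fact stub B is VERBATIM the Literature named fact `sharpLogSobolevAVR_four`
(Balogh–Kristály–Tripaldi 2024, Thm 1.1; `Literature/Geometry/Riemannian/SharpLogSobolevAVR.lean`, p132456):
kernel-checked by `Iff.rfl`. -/
theorem bkt_stub_iff_fact :
    BKTLogSobolevAVRFour ↔ Literature.Geometry.Riemannian.sharpLogSobolevAVR_four := Iff.rfl
theorem coneCoreExistence_holds : ConeCoreExistence := stub_coneCoreExistence
theorem floorBridge_holds : FloorBridge := stub_floorBridge
theorem coneCapping_holds : ConeCapping := stub_coneCapping
theorem scalarPositiveUpgrade_holds : ScalarPositiveUpgrade := stub_scalarPositiveUpgrade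

/-! ### Name-keyed aliases of the statements (the hypotheses of the composition) -/
namespace Registered

/-- Alias of `BKTLogSobolevAVRFour` keyed by the registered stub name. -/
abbrev stub_bktLogSobolevAVRFour : Prop := BKTLogSobolevAVRFour
/-- Alias of `ConeCoreExistence` keyed by the registered stub name. -/
abbrev stub_coneCoreExistence : Prop := ConeCoreExistence
/-- Alias of `FloorBridge` keyed by the registered stub name. -/
abbrev stub_floorBridge : Prop := FloorBridge
/-- Alias of `ConeCapping` keyed by the registered stub name. -/
abbrev stub_coneCapping : Prop := ConeCapping
/-- Alias of `ScalarPositiveUpgrade` keyed by the registered stub name. -/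
abbrev stub_scalarPositiveUpgrade : Prop := ScalarPositiveUpgrade

end Registered

/-! ## Numbers of the line (sorry-free) -/

/-- The slope threshold: `c³ > Θ(S³×ℝ) = 2√π e^{−3/2}` is `3 log c > ν_cyl`. -/
theorem log_threshold {c : ℝ} (h : 2 * Real.sqrt Real.pi * Real.exp (-(3 : ℝ) / 2) < c ^ 3) :
    Real.log 2 + Real.log Real.pi / 2 - 3 / 2 < 3 * Real.log c := by
  have hpos : 0 < 2 * Real.sqrt Real.pi * Real.exp (-(3 : ℝ) / 2) := by positivity
  have hlog := Real.log_lt_log hpos h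
  have hsqrt : Real.log (Real.sqrt Real.pi) = Real.log Real.pi / 2 := by
    rw [Real.sqrt_eq_rpow, Real.log_rpow Real.pi_pos]; ring
  rw [Real.log_mul (by positivity) (Real.exp_pos _).ne', Real.log_mul (by norm_num) (by positivity),
    Real.log_exp, hsqrt, Real.log_pow] at hlog
  push_cast at hlog
  linarith

/-- The cap's margin is the route's window: `min(3 log c, log 6 − 2) > ν_cyl`
(`Negative.Window.nuCyl_lt_nuRound`). -/
theorem cap_margin {c : ℝ} (h : 2 * Real.sqrt Real.pi * Real.exp (-(3 : ℝ) / 2) < c ^ 3) :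
    Real.log 2 + Real.log Real.pi / 2 - 3 / 2 < min (3 * Real.log c) (Real.log 6 - 2) :=
  lt_min (log_threshold h) Summit.SmoothPoincare4.Cruxes.SubcylindricalExistence.Negative.nuCyl_lt_nuRound

/-! ## The composition: the stubs imply the crux BY NAME (kernel-checked; no `sorry` below).

`stub_bktLogSobolevAVRFour` is the inline statement of a PUBLISHED theorem (BKT Thm 1.1), registered as
a named-fact stub: the crux follows from the other four stubs conditionally on it, unconditionally once
the Literature fact is proved (`exact …_holds`). -/

/-- **`SubcylindricalExistence_of`** — the glue of the line: for `M ≃ₕ S⁴`, the transfer stub gives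
`(g, p, r, Λ, c, P, h, ι, σ)`; the bridge turns BKT on the complete `Ric ≥ 0` core of AVR `c³` into
the floor `3 log c` on `M` and `R_{Λ²g} ≥ 0` off `p`; capping closes it inside `M` at level
`min(3 log c, log 6 − 2) − ε`; the upgrade makes `R > 0` at level `min − 2ε`; with
`ε = (min − ν_cyl)/3 > 0` (`cap_margin`) this is ENT for `M` with `δ = ε`, verbatim. -/
theorem SubcylindricalExistence_of (hBKT : Registered.stub_bktLogSobolevAVRFour)
    (hCore : Registered.stub_coneCoreExistence) :
    Summit.SmoothPoincare4.SmoothPoincare4.Theses.EntropyRung.SubcylindricalExistence := by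
  -- the bridge F (p129780), the capping K and the upgrade U (p130772) are PROVED: no longer hypotheses
  have hBridge : Registered.stub_floorBridge := floorBridge_holds
  have hCap : Registered.stub_coneCapping := coneCapping_holds
  have hUp : Registered.stub_scalarPositiveUpgrade := scalarPositiveUpgrade_holds
  intro M _ _ _ _ _ _ _ _ _ e
  -- `M ≃ₕ S⁴` is connected: `S⁴` is path connected and path components are homotopy invariants
  haveI : PathConnectedSpace (Metric.sphere (0 : EuclideanSpace ℝ (Fin 5)) 1) := by
    refine isPathConnected_iff_pathConnectedSpace.mp (isPathConnected_sphere ?_ 0 zero_le_one)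
    rw [← Module.finrank_eq_rank, finrank_euclideanSpace_fin]
    exact Nat.one_lt_cast.mpr (by norm_num)
  haveI : PathConnectedSpace M :=
    Literature.Topology.FourManifolds.pathConnectedSpace_of_homotopyEquiv e
  obtain ⟨g, _, hg, p, r, Λ, c, P, _, _, _, _, _, _, _, _, _, _, h, _, hh, ι, σ, hflat, hcone, hlink,
    hgeom, ⟨hr, hc, hc1⟩, hc3⟩ := hCore M e
  -- the floor on `M` and `R_{Λ²g} ≥ 0` off `p`, from BKT on the core
  obtain ⟨hfloor, hRΛ⟩ := hBridge hBKT M g hg p Λ c P h hh ι σ hcone.1 hcone.2.1 hc hlink hgeom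
  -- the margin
  set ν₀ : ℝ := Real.log 2 + Real.log Real.pi / 2 - 3 / 2 with hν₀
  set m : ℝ := min (3 * Real.log c) (Real.log 6 - 2) with hm
  have hmar : ν₀ < m := cap_margin hc3
  set ε : ℝ := (m - ν₀) / 3 with hε
  have hεpos : 0 < ε := by rw [hε]; linarith
  -- cap inside `M`, then make the scalar curvature positive
  obtain ⟨G, _, hG, hR0, hRpos, hν⟩ :=
    hCap hBKT M g hg p r Λ c hflat hcone hr hc hc1 hRΛ hfloor ε hεpos
  obtain ⟨G', hLC', hG', hR', hν'⟩ := hUp M G hG (m - ε) hR0 hRpos hν ε hεpos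
  refine ⟨G', hLC', hG', hR', ε, hεpos, fun τ hτ f hf hnorm ↦ ?_⟩
  have h1 := hν' τ hτ f hf hnorm
  have h2 : ν₀ + ε = m - ε - ε := by rw [hε]; ring
  rw [h2]
  exact h1

/-- Wiring check: the registered stubs feed `SubcylindricalExistence_of` as stated. -/
example : Summit.SmoothPoincare4.SmoothPoincare4.Theses.EntropyRung.SubcylindricalExistence :=
  SubcylindricalExistence_of stub_bktLogSobolevAVRFour stub_coneCoreExistence

end Summit.SmoothPoincare4.SmoothPoincare4.Cruxes.SubcylindricalExistence.FatConicalCoreAvrLogsobolev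

end
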